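import Mathlib.Algebra.Order.Chebyshev
import Literature.Probability.LatticeModels.GKSInequalities
import HarnessLib

/-!
# Finite-energy lower bounds for truncated correlations of ferromagnetic spin systems, and the
# energy–energy truncated correlation of the plus-state Ising model on `ℤ^d`

For the general ferromagnetic spin system `ν_{Λ;K} ∝ exp{∑ᵢ Kᵢ ω_{Cᵢ}}`, `Kᵢ ≥ 0`, of
Friedli–Velenik, *Statistical Mechanics of Lattice Systems* (CUP 2017) §3.8.1 — the tree's
`gksExpect s K C` (`GKSInequalities.lean`) — Ginibre's duplicated system (the proof of F–V Thm. 3.49,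
p. 142, tree `sum_sum_mul_gksWeight_eq`) gives the IDENTITY behind the second GKS inequality:

  `Z² (⟨σ_Aσ_B⟩ - ⟨σ_A⟩⟨σ_B⟩) = ∑_{ω''} (1 - ω''_B) · Z_{K(1+ω'')} ⟨σ_{A∆B}⟩_{K(1+ω'')}`,
  `K(1+ω'')ᵢ = Kᵢ (1 + ω''_{Cᵢ}) ≥ 0`                                   (`gksSum_truncated_eq_sum_twisted`)

(F–V p. 142, display after «Introducing the variables `ω''ᵢ = ωᵢω'ᵢ`»). Every summand is `≥ 0`
(GKS I), which is GKS II; this file extracts a quantitative LOWER bound from the same identity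
(§1–§4, model-independent), and applies it to the energy–energy truncated correlation of the
plus-state Ising model on `ℤ^d` (§5–§7):

* §1 the identity and the normalisation `Z² = ∑_{ω''} Z_{K(1+ω'')}`;
* §2 Griffiths' comparison along a chain of bonds: `⟨σ_{u₀}σ_{u_n}⟩_K ≥ ∏_j tanh K_{e_j}` for any
  chain of interaction terms `C_{e_j} = {u_j, u_{j+1}}` (F–V Exercise 3.31 — tree
  `gksExpect_mono_of_abs_le` — and GKS II);
* §3 FINITE ENERGY of the duplicated measure: for a set of sites `T` and a pattern `p`,
  `∑_{ω'' = p on T} Z_{K(1+ω'')} ≥ e^{-2∑_{i : p_{Cᵢ} = -1} Kᵢ} · 2^{-|T|} · Z²`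
  (flip by `p`, then the freezing identity `1{ω'' ≡ 1 on T} = 2^{-|T|} ∑_{S ⊆ T} ω''_S` of the tree,
  `sum_filter_frozen_eq`, turns `∑_{ω'' ≡ 1 on T} Z_{K(1+ω'')}` into `2^{-|T|} ∑_{S⊆T} (Z⟨σ_S⟩)²`);
* §4 the assembled bound `⟨σ_Aσ_B⟩ - ⟨σ_A⟩⟨σ_B⟩ ≥ 2c · e^{-2∑_{p_{Cᵢ}=-1}Kᵢ} · 2^{-|T|}` whenever
  `B ⊆ T`, `p_B = -1` and `⟨σ_{A∆B}⟩_{K(1+ω'')} ≥ c` for every `ω''` agreeing with `p` on `T`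
  (`gksExpect_truncated_ge`);
* §5–§6 the Ising model with `+` boundary condition on a box of `ℤ^d` at `h = 0` (tree bridge
  `isingCorr_eq_gksExpect`): for the two bonds `{x - e_k, x}` and `{x + (N-1)e_k, x + N e_k}` on a
  coordinate axis, `N ≥ 1`, and any second direction `e_l`, `l ≠ k`, the pattern «`-1` on the
  segment `x, x + e_k, …, x + (N-1)e_k`, `+1` elsewhere» and the two monochromatic chains (the
  segment, `N - 1` bonds at doubled coupling `2β`; the detour `x - e_k, x - e_k + e_l, …,
  x + N e_k + e_l, x + N e_k`, `N + 3` bonds) give, uniformly in the box,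
  `⟨σ_{x-e_k}σ_x ; σ_{x+(N-1)e_k}σ_{x+Ne_k}⟩⁺_{Λ;β} ≥ 2 tanh(2β)^{2N+2} e^{-4dβN} 2^{-(2N+4)}`
  (`isingCorr_plus_energyPair_truncated_ge`);
* §7 the same in the infinite-volume plus state `⟨·⟩⁺_{β,0}` of `ℤ^d` (`plusCorr`, box limits of the
  tree), and in exponential form `∃ c₁ > 0, ∀ x, ∀ N ≥ 1, e^{-c₁N} ≤ ⟨ε_x ; ε_{x+Ne_k}⟩⁺_β` for
  `β > 0` (`plusCorr_energyPair_truncated_ge`, `plusCorr_energyPair_truncated_ge_exp`).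

Purpose (cell `ym-ir`, census row A5): under the duality of truncated correlations
`Cov_β(W_{σ(x)}, W_{σ(x)+Ne₃}) = sinh²(2β*)·⟨ε ; ε'⟩⁺_{β*}` (tree
`Z2Duality.z2PlaquettePairCov_eq_sinh_sq_mul_plusCov`) §7 is the finite-energy LOWER bound
`e^{-c₁N} ≤ Cov` of Duncan–Schweinhart 2026 Prop. 24 ∕ Thm 8 for `ℤ₂` lattice gauge theory on `ℤ³`
(«There is a trivial exponential lower bound … found by considering the event that all plaquettes
in a minimal set whose boundary is `γ - γ'` are open», arXiv:2607.02434 p. 19), obtained here on the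
spin side and without the random-cluster representation; see
`Literature/MathematicalPhysics/QuantumFieldTheory/IsingGaugePlaquetteCovarianceLowerBound.lean`.
No new definitions, no named facts.

## References

* S. Friedli, Y. Velenik, *Statistical Mechanics of Lattice Systems*, CUP (2017), §3.8.1 Thm. 3.49
  and its proof (pp. 141–142), Exercises 3.12, 3.31. [FriedliVelenik2017]
* J. Ginibre, *General formulation of Griffiths' inequalities*, Comm. Math. Phys. 16 (1970) 310–328.
* R. B. Griffiths, *Correlations in Ising ferromagnets II*, J. Math. Phys. 8 (1967) 484–489
  (comparison of a ferromagnet with a chain, `⟨σ_0σ_n⟩ ≥ ∏ tanh J`).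
* P. Duncan, B. Schweinhart, *A topological formula for Potts lattice gauge theory correlations*,
  arXiv:2607.02434 (2026), Prop. 24 (p. 19). [DuncanSchweinhart2026]
-/

noncomputable section

open Finset Filter Topology
open scoped symmDiff

namespace Literature.Probability.LatticeModels

variable {Λ : Type*} {ι : Type*}

/-! ### §1 Ginibre's identity for the truncated correlation -/

section Abstract

variable [Fintype Λ] [DecidableEq Λ]
variable (s : Finset ι) (K : ι → ℝ) (C : ι → Finset Λ)

omit [Fintype Λ] [DecidableEq Λ] in
/-- `ω ω = 1` for `±1`-valued configurations. [folklore] -/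
private theorem cfg_mul_self (ω : SpinConfig Λ) : ω * ω = 1 :=
  funext fun x => Int.units_mul_self (ω x)

omit [Fintype Λ] [DecidableEq Λ] in
/-- `ω (ω ω') = ω'`. [folklore] -/
private theorem cfg_mul_mul_cancel (ω ω' : SpinConfig Λ) : ω * (ω * ω') = ω' := by
  rw [← mul_assoc, cfg_mul_self, one_mul]

/-- **Normalisation of the duplicated system**: `Z_K² = ∑_{ω''} Z_{K(1+ω'')}` with the twisted
couplings `Kᵢ + Kᵢ ω''_{Cᵢ}` (Friedli–Velenik 2017, proof of Thm. 3.49, p. 142, the change of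
variables `ω' = ω ω''` applied to `Z_K · Z_K`). [cite: FriedliVelenik2017, proof of Thm. 3.49, p. 142] -/
theorem gksSum_one_mul_self_eq_sum_twisted :
    gksSum s K C (fun _ => 1) * gksSum s K C (fun _ => 1) =
      ∑ ω'' : SpinConfig Λ, gksSum s (fun i => K i + K i * spinProduct (C i) ω'') C (fun _ => 1) := by
  have h := sum_sum_mul_gksWeight_eq s K C K (fun _ _ => (1 : ℝ))
  simp only [one_mul] at h
  simp only [gksSum, one_mul]
  rw [Finset.sum_mul_sum]
  exact h

/-- The twisted partition function as a duplicated sum: `Z_{K(1+ω'')} = ∑_ω e^{H_K(ω)} e^{H_K(ωω'')}`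
(Friedli–Velenik 2017, proof of Thm. 3.49, p. 142). [cite: FriedliVelenik2017, proof of Thm. 3.49, p. 142] -/
theorem gksSum_twisted_one_eq (ω'' : SpinConfig Λ) :
    gksSum s (fun i => K i + K i * spinProduct (C i) ω'') C (fun _ => 1) =
      ∑ ω : SpinConfig Λ, gksWeight s K C ω * gksWeight s K C (ω * ω'') := by
  simp only [gksSum, one_mul]
  exact Finset.sum_congr rfl fun ω _ => (gksWeight_mul_gksWeight_mul s K C K ω ω'').symm

/-- **Ginibre's identity for the truncated correlation** (the display in the proof of
Friedli–Velenik 2017, Thm. 3.49, p. 142, before discarding the sign information):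
`Z⟨σ_Aσ_B⟩·Z - Z⟨σ_A⟩·Z⟨σ_B⟩ = ∑_{ω''} (1 - ω''_B) ∑_ω ω_{A∆B} e^{∑ Kᵢ(1+ω''_{Cᵢ}) ω_{Cᵢ}}`.
[cite: FriedliVelenik2017, proof of Thm. 3.49, p. 142] -/
theorem gksSum_truncated_eq_sum_twisted (A B : Finset Λ) :
    gksSum s K C (spinProduct (A ∆ B)) * gksSum s K C (fun _ => 1) -
        gksSum s K C (spinProduct A) * gksSum s K C (spinProduct B) =
      ∑ ω'' : SpinConfig Λ, (1 - spinProduct B ω'') *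
        gksSum s (fun i => K i + K i * spinProduct (C i) ω'') C (spinProduct (A ∆ B)) := by
  have key : gksSum s K C (spinProduct (A ∆ B)) * gksSum s K C (fun _ => 1) -
      gksSum s K C (spinProduct A) * gksSum s K C (spinProduct B) =
      ∑ ω, ∑ ω', spinProduct A ω * (spinProduct B ω - spinProduct B ω') *
        (gksWeight s K C ω * gksWeight s K C ω') := by
    rw [gksSum, gksSum, gksSum, gksSum, Finset.sum_mul_sum, Finset.sum_mul_sum,
      ← Finset.sum_sub_distrib]
    refine Finset.sum_congr rfl fun ω _ => ?_
    rw [← Finset.sum_sub_distrib]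
    refine Finset.sum_congr rfl fun ω' _ => ?_
    rw [← spinProduct_mul_eq_spinProduct_symmDiff]
    ring
  rw [key, sum_sum_mul_gksWeight_eq]
  refine Finset.sum_congr rfl fun ω'' _ => ?_
  have h2 : ∀ ω : SpinConfig Λ, spinProduct A ω * (spinProduct B ω - spinProduct B (ω * ω'')) =
      (1 - spinProduct B ω'') * spinProduct (A ∆ B) ω := by
    intro ω
    rw [spinProduct_mul_cfg, ← spinProduct_mul_eq_spinProduct_symmDiff]
    ring
  simp_rw [h2, mul_assoc, ← Finset.mul_sum]
  rfl

/-! ### §2 Griffiths' comparison with a single bond and with a chain of bonds -/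

/-- `∑_ω ω_B = 0` for `B ≠ ∅` (flip one spin of `B`; Friedli–Velenik 2017, §3.7.3). [cite: FriedliVelenik2017, §3.7.3] -/
private theorem sum_spinProduct_eq_zero {B : Finset Λ} (hB : B.Nonempty) :
    ∑ ω : SpinConfig Λ, spinProduct B ω = 0 := by
  obtain ⟨b, hb⟩ := hB
  set δ : SpinConfig Λ := Function.update 1 b (-1) with hδ
  have hδB : spinProduct B δ = -1 := by
    rw [spinProduct, ← Finset.mul_prod_erase _ _ hb]
    have h1 : spinAt b δ = -1 := by simp [spinAt, hδ]
    have h2 : ∏ x ∈ B.erase b, spinAt x δ = 1 := Finset.prod_eq_one fun x hx => by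
      simp [spinAt, hδ, Function.update_of_ne (Finset.ne_of_mem_erase hx)]
    rw [h1, h2]; norm_num
  have h : ∑ ω : SpinConfig Λ, spinProduct B (ω * δ) = ∑ ω : SpinConfig Λ, spinProduct B ω :=
    Fintype.sum_equiv (Equiv.mulRight δ) _ _ fun _ => rfl
  simp only [spinProduct_mul_cfg, hδB, mul_neg, mul_one, Finset.sum_neg_distrib] at h
  linarith

omit [Fintype Λ] [DecidableEq Λ] in
/-- `tanh K ≥ 0` for `K ≥ 0`. [folklore] -/
private theorem tanh_nonneg_aux {K : ℝ} (hK : 0 ≤ K) : 0 ≤ Real.tanh K := by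
  rw [Real.tanh_eq_sinh_div_cosh]
  exact div_nonneg (Real.sinh_nonneg_iff.2 hK) (Real.cosh_pos K).le

/-- **One bond**: in the system with a single interaction term `K ω_C`, `C ≠ ∅`,
`⟨σ_C⟩ = tanh K` (`e^{Kω_C} = cosh K + ω_C sinh K`, Friedli–Velenik 2017 eq. (3.44)). [cite: FriedliVelenik2017, §3.7.3, eq. (3.44)] -/
theorem gksExpect_singleCoupling_eq [DecidableEq ι] {i₀ : ι} (hi₀ : i₀ ∈ s) (k : ℝ)
    (hC : (C i₀).Nonempty) :
    gksExpect s (fun i => if i = i₀ then k else 0) C (spinProduct (C i₀)) = Real.tanh k := by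
  have hw : ∀ ω : SpinConfig Λ, gksWeight s (fun i => if i = i₀ then k else 0) C ω =
      Real.cosh k + spinProduct (C i₀) ω * Real.sinh k := by
    intro ω
    rw [gksWeight, gksHamiltonian, Finset.sum_eq_single i₀ (fun i _ hi => by rw [if_neg hi, zero_mul])
      (fun h => (h hi₀).elim), if_pos rfl]
    exact exp_mul_eq_cosh_add_mul_sinh k (spinProduct_eq_one_or (C i₀) ω)
  have hcard : (0 : ℝ) < Fintype.card (SpinConfig Λ) := by exact_mod_cast Fintype.card_pos
  have hnum : gksSum s (fun i => if i = i₀ then k else 0) C (spinProduct (C i₀)) =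
      Fintype.card (SpinConfig Λ) * Real.sinh k := by
    simp only [gksSum, hw]
    have : ∀ ω : SpinConfig Λ, spinProduct (C i₀) ω * (Real.cosh k + spinProduct (C i₀) ω * Real.sinh k)
        = Real.cosh k * spinProduct (C i₀) ω + Real.sinh k := by
      intro ω
      have := spinProduct_mul_self (C i₀) ω
      linear_combination Real.sinh k * this
    simp_rw [this]
    rw [Finset.sum_add_distrib, ← Finset.mul_sum, sum_spinProduct_eq_zero hC, mul_zero, zero_add,
      Finset.sum_const, nsmul_eq_mul, Finset.card_univ]
  have hden : gksSum s (fun i => if i = i₀ then k else 0) C (fun _ => 1) =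
      Fintype.card (SpinConfig Λ) * Real.cosh k := by
    simp only [gksSum, hw, one_mul]
    rw [Finset.sum_add_distrib, ← Finset.sum_mul, sum_spinProduct_eq_zero hC, zero_mul, add_zero,
      Finset.sum_const, nsmul_eq_mul, Finset.card_univ]
  rw [gksExpect, hnum, hden, Real.tanh_eq_sinh_div_cosh,
    mul_div_mul_left _ _ hcard.ne']

/-- **Griffiths' comparison with a single bond**: for `Kᵢ ≥ 0` and any interaction term `i₀`,
`⟨σ_{C_{i₀}}⟩_{Λ;K} ≥ tanh K_{i₀}` (Friedli–Velenik 2017, Exercise 3.31 with `K'` the single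
coupling `K_{i₀}`; R. B. Griffiths, J. Math. Phys. 8 (1967) 484, Thm.). [cite: FriedliVelenik2017, Exercise 3.31, p. 142] -/
theorem tanh_le_gksExpect_single [DecidableEq ι] (hK : ∀ i ∈ s, 0 ≤ K i) {i₀ : ι} (hi₀ : i₀ ∈ s) :
    Real.tanh (K i₀) ≤ gksExpect s K C (spinProduct (C i₀)) := by
  rcases (C i₀).eq_empty_or_nonempty with hC | hC
  · -- `σ_∅ = 1`, `⟨1⟩ = 1 ≥ tanh`
    have h1 : spinProduct (C i₀) = fun _ : SpinConfig Λ => (1 : ℝ) := by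
      funext ω; rw [hC, spinProduct_empty]
    rw [h1, gksExpect, div_self (gksSum_one_pos s K C).ne']
    exact (Real.tanh_lt_one _).le
  · have hcmp : ∀ i ∈ s, |(fun i => if i = i₀ then K i₀ else 0) i| ≤ K i := by
      intro i hi
      by_cases h : i = i₀
      · subst h; simp [abs_of_nonneg (hK i hi)]
      · simp [h, hK i hi]
    calc Real.tanh (K i₀)
        = gksExpect s (fun i => if i = i₀ then K i₀ else 0) C (spinProduct (C i₀)) :=
          (gksExpect_singleCoupling_eq s C hi₀ (K i₀) hC).symm
      _ ≤ gksExpect s K C (spinProduct (C i₀)) := gksExpect_mono_of_abs_le s C hcmp (C i₀)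

/-- **Griffiths' chain bound**: if `C_{e_j} = {u_j} ∆ {u_{j+1}}` for `j < n` are interaction terms of
a ferromagnetic system (`Kᵢ ≥ 0`), then `⟨σ_{u_0} σ_{u_n}⟩_{Λ;K} ≥ ∏_{j<n} tanh K_{e_j}` — GKS II
`⟨σ_{X∆Y}⟩ ≥ ⟨σ_X⟩⟨σ_Y⟩` along the chain and the single-bond comparison (R. B. Griffiths 1967 II;
Friedli–Velenik 2017 Thm. 3.49 (3.55) + Exercise 3.31). The pair is written `{u_0} ∆ {u_n}` (`= ∅`,
`σ_∅ = 1`, when `u_0 = u_n`). [cite: FriedliVelenik2017, Thm. 3.49 and Exercise 3.31, pp. 141–142] -/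
theorem prod_tanh_le_gksExpect_chain [DecidableEq ι] (hK : ∀ i ∈ s, 0 ≤ K i) (u : ℕ → Λ) (e : ℕ → ι) :
    ∀ n : ℕ, (∀ j < n, e j ∈ s ∧ C (e j) = {u j} ∆ {u (j + 1)}) →
      ∏ j ∈ Finset.range n, Real.tanh (K (e j)) ≤
        gksExpect s K C (spinProduct (({u 0} : Finset Λ) ∆ {u n}))
  | 0, _ => by
    have h1 : spinProduct ((({u 0} : Finset Λ) ∆ {u 0})) = fun _ : SpinConfig Λ => (1 : ℝ) := by
      funext ω; rw [symmDiff_self, Finset.bot_eq_empty, spinProduct_empty]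
    rw [Finset.prod_range_zero, h1, gksExpect, div_self (gksSum_one_pos s K C).ne']
  | n + 1, h => by
    obtain ⟨hes, hCe⟩ := h n (Nat.lt_succ_self n)
    have ih := prod_tanh_le_gksExpect_chain hK u e n fun j hj => h j (Nat.lt_succ_of_lt hj)
    have h1 : Real.tanh (K (e n)) ≤ gksExpect s K C (spinProduct (({u n} : Finset Λ) ∆ {u (n + 1)})) := by
      rw [← hCe]; exact tanh_le_gksExpect_single s K C hK hes
    have hsd : (({u 0} : Finset Λ) ∆ {u (n + 1)}) =
        ((({u 0} : Finset Λ) ∆ {u n})) ∆ ((({u n} : Finset Λ) ∆ {u (n + 1)})) := by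
      rw [symmDiff_assoc, symmDiff_symmDiff_cancel_left]
    rw [Finset.prod_range_succ, hsd]
    calc (∏ j ∈ Finset.range n, Real.tanh (K (e j))) * Real.tanh (K (e n))
        ≤ gksExpect s K C (spinProduct (({u 0} : Finset Λ) ∆ {u n})) *
            gksExpect s K C (spinProduct (({u n} : Finset Λ) ∆ {u (n + 1)})) :=
          mul_le_mul ih h1 (tanh_nonneg_aux (hK _ hes))
            (gksExpect_spinProduct_nonneg s K C hK _)
      _ ≤ _ := gksExpect_mul_gksExpect_le s K C hK _ _

/-! ### §3 Finite energy of the duplicated measure -/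

omit [Fintype Λ] [DecidableEq Λ] in
/-- **Flipping by a pattern costs at most `e^{2∑_{p_{Cᵢ} = -1} Kᵢ}`**: for `Kᵢ ≥ 0` and any
configurations `η`, `p`, `e^{H_K(η p)} ≥ e^{-2∑_{i : p_{Cᵢ} = -1} Kᵢ} e^{H_K(η)}` (only the terms
with `p_{Cᵢ} = -1` change, each by at most `2Kᵢ`). [folklore] -/
private theorem gksWeight_mul_pattern_ge (hK : ∀ i ∈ s, 0 ≤ K i) (p η : SpinConfig Λ) :
    Real.exp (-2 * ∑ i ∈ s with spinProduct (C i) p = -1, K i) * gksWeight s K C η ≤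
      gksWeight s K C (η * p) := by
  rw [gksWeight, gksWeight, ← Real.exp_add, Real.exp_le_exp, gksHamiltonian, gksHamiltonian,
    Finset.sum_filter, Finset.mul_sum, ← Finset.sum_add_distrib]
  refine Finset.sum_le_sum fun i hi => ?_
  rw [spinProduct_mul_cfg]
  have hKi := hK i hi
  have hη := abs_le.1 (abs_spinProduct_le_one (C i) η)
  rcases spinProduct_eq_one_or (C i) p with h1 | h1
  · rw [h1, if_neg (by norm_num)]; simp
  · rw [h1, if_pos rfl]; nlinarith

/-- Summed form: `Z_{K(1+ζp)} ≥ e^{-2∑_{p_{Cᵢ}=-1}Kᵢ} Z_{K(1+ζ)}` for all `ζ`. [folklore] -/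
private theorem gksSum_twisted_mul_pattern_ge (hK : ∀ i ∈ s, 0 ≤ K i) (p ζ : SpinConfig Λ) :
    Real.exp (-2 * ∑ i ∈ s with spinProduct (C i) p = -1, K i) *
        gksSum s (fun i => K i + K i * spinProduct (C i) ζ) C (fun _ => 1) ≤
      gksSum s (fun i => K i + K i * spinProduct (C i) (ζ * p)) C (fun _ => 1) := by
  rw [gksSum_twisted_one_eq, gksSum_twisted_one_eq, Finset.mul_sum]
  refine Finset.sum_le_sum fun ω _ => ?_
  rw [← mul_assoc ω ζ p, mul_left_comm]
  exact mul_le_mul_of_nonneg_left (gksWeight_mul_pattern_ge s K C hK p (ω * ζ)) (gksWeight_pos s K C ω).le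

/-- **The freezing identity for the duplicated measure**: `∑_{ω'' ≡ 1 on T} Z_{K(1+ω'')} =
2^{-|T|} ∑_{S ⊆ T} (Z⟨σ_S⟩_K)²` — `1{ω'' ≡ 1 on T} = 2^{-|T|}∑_{S⊆T} ω''_S` (tree
`sum_filter_frozen_eq`) and `∑_{ω''} ω''_S e^{H(ω)}e^{H(ωω'')} = ω_S e^{H(ω)} · ∑_{ω'} ω'_S e^{H(ω')}`
after `ω' = ω ω''`. [cite: FriedliVelenik2017, proof of Thm. 3.49 (p. 142) and Exercise 3.12] -/
theorem sum_frozen_gksSum_twisted_eq (T : Finset Λ) :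
    ∑ ω'' ∈ univ.filter (fun ω'' : SpinConfig Λ => ∀ x ∈ T, ω'' x = 1),
        gksSum s (fun i => K i + K i * spinProduct (C i) ω'') C (fun _ => 1) =
      ((2 : ℝ) ^ #T)⁻¹ * ∑ S ∈ T.powerset, gksSum s K C (spinProduct S) ^ 2 := by
  rw [sum_filter_frozen_eq]
  congr 1
  refine Finset.sum_congr rfl fun S _ => ?_
  simp_rw [gksSum_twisted_one_eq, Finset.mul_sum]
  rw [Finset.sum_comm]
  have hin : ∀ ω : SpinConfig Λ, ∑ ω'' : SpinConfig Λ, spinProduct S ω'' *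
      (gksWeight s K C ω * gksWeight s K C (ω * ω'')) =
      spinProduct S ω * gksWeight s K C ω * ∑ ω' : SpinConfig Λ, spinProduct S ω' * gksWeight s K C ω' := by
    intro ω
    rw [Finset.mul_sum]
    refine Fintype.sum_equiv (Equiv.mulLeft ω) _ _ fun ω'' => ?_
    simp only [Equiv.coe_mulLeft]
    have hS : spinProduct S ω'' = spinProduct S ω * spinProduct S (ω * ω'') := by
      rw [spinProduct_mul_cfg, ← mul_assoc, spinProduct_mul_self, one_mul]
    rw [hS]; ring
  simp_rw [hin]
  rw [← Finset.sum_mul, sq, gksSum]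

/-- **`∑_{ω'' ≡ 1 on T} Z_{K(1+ω'')} ≥ 2^{-|T|} Z²`** (keep the term `S = ∅` of the freezing
identity). [cite: FriedliVelenik2017, proof of Thm. 3.49 (p. 142) and Exercise 3.12] -/
theorem sum_frozen_gksSum_twisted_ge (T : Finset Λ) :
    ((2 : ℝ) ^ #T)⁻¹ * gksSum s K C (fun _ => 1) ^ 2 ≤
      ∑ ω'' ∈ univ.filter (fun ω'' : SpinConfig Λ => ∀ x ∈ T, ω'' x = 1),
        gksSum s (fun i => K i + K i * spinProduct (C i) ω'') C (fun _ => 1) := by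
  rw [sum_frozen_gksSum_twisted_eq]
  refine mul_le_mul_of_nonneg_left ?_ (by positivity)
  have h0 : gksSum s K C (fun _ => 1) ^ 2 = gksSum s K C (spinProduct ∅) ^ 2 := by
    show _ = gksSum s K C (fun ω => spinProduct ∅ ω) ^ 2
    simp only [spinProduct_empty]
  rw [h0]
  exact Finset.single_le_sum (f := fun S => gksSum s K C (spinProduct S) ^ 2)
    (fun S _ => sq_nonneg _) (Finset.empty_mem_powerset T)

/-- **Finite energy of the duplicated measure**: for `Kᵢ ≥ 0`, a set of sites `T` and a pattern `p`,
`∑_{ω'' = p on T} Z_{K(1+ω'')} ≥ e^{-2∑_{p_{Cᵢ}=-1}Kᵢ} · 2^{-|T|} · Z²`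
(the probability, under `ν_K ⊗ ν_K`, that `ω ω'` shows the pattern `p` on `T`). [folklore] -/
private theorem sum_pattern_gksSum_twisted_ge (hK : ∀ i ∈ s, 0 ≤ K i) (T : Finset Λ) (p : SpinConfig Λ) :
    Real.exp (-2 * ∑ i ∈ s with spinProduct (C i) p = -1, K i) * ((2 : ℝ) ^ #T)⁻¹ *
        gksSum s K C (fun _ => 1) ^ 2 ≤
      ∑ ω'' ∈ univ.filter (fun ω'' : SpinConfig Λ => ∀ x ∈ T, ω'' x = p x),
        gksSum s (fun i => K i + K i * spinProduct (C i) ω'') C (fun _ => 1) := by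
  -- reindex `ω'' = ζ p`, `ζ ≡ 1` on `T`
  have hre : ∑ ω'' ∈ univ.filter (fun ω'' : SpinConfig Λ => ∀ x ∈ T, ω'' x = p x),
        gksSum s (fun i => K i + K i * spinProduct (C i) ω'') C (fun _ => 1) =
      ∑ ζ ∈ univ.filter (fun ζ : SpinConfig Λ => ∀ x ∈ T, ζ x = 1),
        gksSum s (fun i => K i + K i * spinProduct (C i) (ζ * p)) C (fun _ => 1) := by
    rw [Finset.sum_filter, Finset.sum_filter]
    refine (Fintype.sum_equiv (Equiv.mulRight p) _ _ fun ζ => ?_).symm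
    simp only [Equiv.coe_mulRight]
    have hiff : (∀ x ∈ T, (ζ * p) x = p x) ↔ ∀ x ∈ T, ζ x = 1 := by
      refine forall₂_congr fun x _ => ?_
      rw [Pi.mul_apply]
      exact mul_eq_right
    simp only [hiff]
  rw [hre, mul_assoc]
  calc Real.exp (-2 * ∑ i ∈ s with spinProduct (C i) p = -1, K i) *
        (((2 : ℝ) ^ #T)⁻¹ * gksSum s K C (fun _ => 1) ^ 2)
      ≤ Real.exp (-2 * ∑ i ∈ s with spinProduct (C i) p = -1, K i) *
          ∑ ζ ∈ univ.filter (fun ζ : SpinConfig Λ => ∀ x ∈ T, ζ x = 1),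
            gksSum s (fun i => K i + K i * spinProduct (C i) ζ) C (fun _ => 1) :=
        mul_le_mul_of_nonneg_left (sum_frozen_gksSum_twisted_ge s K C T) (Real.exp_pos _).le
    _ ≤ _ := by
        rw [Finset.mul_sum]
        exact Finset.sum_le_sum fun ζ _ => gksSum_twisted_mul_pattern_ge s K C hK p ζ

/-! ### §4 The finite-energy lower bound for truncated correlations -/

/-- **Finite-energy lower bound for a truncated correlation of a ferromagnetic spin system.** Let
`Kᵢ ≥ 0`, `A, B ⊆ Λ`, `T` a set of sites with `B ⊆ T`, and `p` a pattern with `p_B = -1`. If for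
every `ω''` that agrees with `p` on `T` the twisted system satisfies `⟨σ_{A∆B}⟩_{K(1+ω'')} ≥ c ≥ 0`,
then
`⟨σ_Aσ_B⟩_K - ⟨σ_A⟩_K⟨σ_B⟩_K ≥ 2c · e^{-2∑_{i : p_{Cᵢ}=-1}Kᵢ} · 2^{-|T|}`.
Proof: in Ginibre's identity (`gksSum_truncated_eq_sum_twisted`) keep the `ω''` that agree with `p`
on `T` (all summands are `≥ 0` by GKS I), where `1 - ω''_B = 2` and `Z_{K(1+ω'')}⟨σ_{A∆B}⟩ ≥ c
Z_{K(1+ω'')}`, and use the finite energy of the duplicated measure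
(`sum_pattern_gksSum_twisted_ge`). (Duncan–Schweinhart 2026, Prop. 24, obtain the corresponding
«trivial exponential lower bound» from finite energy of the plaquette random-cluster measure.) [cite: FriedliVelenik2017, proof of Thm. 3.49, p. 142] -/
theorem gksExpect_truncated_ge [DecidableEq ι] (hK : ∀ i ∈ s, 0 ≤ K i) (A B T : Finset Λ)
    (p : SpinConfig Λ) (hBT : B ⊆ T) (hBp : spinProduct B p = -1) {c : ℝ} (hc0 : 0 ≤ c)
    (hc : ∀ ω'' : SpinConfig Λ, (∀ x ∈ T, ω'' x = p x) →
      c ≤ gksExpect s (fun i => K i + K i * spinProduct (C i) ω'') C (spinProduct (A ∆ B))) :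
    2 * c * (Real.exp (-2 * ∑ i ∈ s with spinProduct (C i) p = -1, K i) * ((2 : ℝ) ^ #T)⁻¹) ≤
      gksExpect s K C (spinProduct (A ∆ B)) -
        gksExpect s K C (spinProduct A) * gksExpect s K C (spinProduct B) := by
  have hZ : 0 < gksSum s K C (fun _ => 1) := gksSum_one_pos s K C
  set E := univ.filter (fun ω'' : SpinConfig Λ => ∀ x ∈ T, ω'' x = p x) with hE
  -- the truncated correlation as a normalised Ginibre sum
  have hrepr : gksExpect s K C (spinProduct (A ∆ B)) -
      gksExpect s K C (spinProduct A) * gksExpect s K C (spinProduct B) =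
      (∑ ω'' : SpinConfig Λ, (1 - spinProduct B ω'') *
        gksSum s (fun i => K i + K i * spinProduct (C i) ω'') C (spinProduct (A ∆ B))) /
        (gksSum s K C (fun _ => 1) * gksSum s K C (fun _ => 1)) := by
    rw [← gksSum_truncated_eq_sum_twisted, gksExpect, gksExpect, gksExpect]
    field_simp
  -- every summand is nonnegative (GKS I in the twisted system)
  have hnn : ∀ ω'' : SpinConfig Λ, 0 ≤ (1 - spinProduct B ω'') *
      gksSum s (fun i => K i + K i * spinProduct (C i) ω'') C (spinProduct (A ∆ B)) := fun ω'' =>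
    mul_nonneg (one_sub_spinProduct_nonneg B ω'')
      (gksSum_spinProduct_nonneg s _ C (twisted_nonneg_of_nonneg s C hK ω'') _)
  -- on `E`: `1 - ω''_B = 2` and `Z_tw ⟨σ⟩_tw ≥ c Z_tw`
  have hE_B : ∀ ω'' ∈ E, spinProduct B ω'' = -1 := by
    intro ω'' hω
    rw [hE, Finset.mem_filter] at hω
    rw [← hBp, spinProduct, spinProduct]
    exact Finset.prod_congr rfl fun x hx => by rw [spinAt, spinAt, hω.2 x (hBT hx)]
  have hE_c : ∀ ω'' ∈ E, c * gksSum s (fun i => K i + K i * spinProduct (C i) ω'') C (fun _ => 1) ≤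
      gksSum s (fun i => K i + K i * spinProduct (C i) ω'') C (spinProduct (A ∆ B)) := by
    intro ω'' hω
    rw [hE, Finset.mem_filter] at hω
    have hZt := gksSum_one_pos s (fun i => K i + K i * spinProduct (C i) ω'') C
    have := hc ω'' hω.2
    rw [gksExpect, le_div_iff₀ hZt] at this
    exact this
  have hsum : 2 * c * ∑ ω'' ∈ E, gksSum s (fun i => K i + K i * spinProduct (C i) ω'') C (fun _ => 1) ≤
      ∑ ω'' : SpinConfig Λ, (1 - spinProduct B ω'') *
        gksSum s (fun i => K i + K i * spinProduct (C i) ω'') C (spinProduct (A ∆ B)) := by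
    calc 2 * c * ∑ ω'' ∈ E, gksSum s (fun i => K i + K i * spinProduct (C i) ω'') C (fun _ => 1)
        = ∑ ω'' ∈ E, 2 * (c * gksSum s (fun i => K i + K i * spinProduct (C i) ω'') C (fun _ => 1)) := by
          rw [Finset.mul_sum]; exact Finset.sum_congr rfl fun _ _ => by ring
      _ ≤ ∑ ω'' ∈ E, (1 - spinProduct B ω'') *
            gksSum s (fun i => K i + K i * spinProduct (C i) ω'') C (spinProduct (A ∆ B)) := by
          refine Finset.sum_le_sum fun ω'' hω => ?_
          rw [hE_B ω'' hω, show (1 : ℝ) - -1 = 2 by norm_num]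
          exact mul_le_mul_of_nonneg_left (hE_c ω'' hω) (by norm_num)
      _ ≤ _ := Finset.sum_le_univ_sum_of_nonneg hnn
  have hfe := sum_pattern_gksSum_twisted_ge s K C hK T p
  rw [hrepr, le_div_iff₀ (mul_pos hZ hZ)]
  have h2c : 0 ≤ 2 * c := by positivity
  calc 2 * c * (Real.exp (-2 * ∑ i ∈ s with spinProduct (C i) p = -1, K i) * ((2 : ℝ) ^ #T)⁻¹) *
        (gksSum s K C (fun _ => 1) * gksSum s K C (fun _ => 1))
      = 2 * c * (Real.exp (-2 * ∑ i ∈ s with spinProduct (C i) p = -1, K i) * ((2 : ℝ) ^ #T)⁻¹ *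
          gksSum s K C (fun _ => 1) ^ 2) := by
        ring
    _ ≤ 2 * c * ∑ ω'' ∈ E, gksSum s (fun i => K i + K i * spinProduct (C i) ω'') C (fun _ => 1) :=
        mul_le_mul_of_nonneg_left hfe h2c
    _ ≤ _ := hsum

end Abstract

/-! ### §5 The plus-boundary Ising box on `ℤ^d` as `ν_{Λ;K}`: edge supports, twisted couplings,
straight chains -/

section IsingBox

variable {V : Type*} [DecidableEq V]

/-- The trace of a singleton `{z}`, `z ∈ Λ`, is the singleton of the subtype. [folklore] -/
private theorem inVol_singleton {Λ : Finset V} {z : V} (hz : z ∈ Λ) :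
    inVol Λ ({z} : Finset V) = {⟨z, hz⟩} := by
  ext w
  rw [mem_inVol, Finset.mem_singleton, Finset.mem_singleton, Subtype.ext_iff]

/-- `#(inVol Λ A) ≤ #A`. [folklore] -/
private theorem card_inVol_le (Λ A : Finset V) : #(inVol Λ A) ≤ #A :=
  Finset.card_le_card_of_injOn (fun z : ↥Λ => (z : V)) (fun z hz => by simpa using hz)
    (Set.injOn_of_injective Subtype.val_injective)

/-- A pair is the symmetric difference of its singletons. [folklore] -/
private theorem pair_eq_symmDiff' {α : Type*} [DecidableEq α] {a b : α} (h : a ≠ b) :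
    ({a, b} : Finset α) = {a} ∆ {b} := by
  ext z
  simp only [Finset.mem_insert, Finset.mem_singleton, Finset.mem_symmDiff]
  constructor
  · rintro (rfl | rfl)
    · exact Or.inl ⟨rfl, h⟩
    · exact Or.inr ⟨rfl, fun h' => h h'.symm⟩
  · rintro (⟨h1, -⟩ | ⟨h1, -⟩)
    · exact Or.inl h1
    · exact Or.inr h1

/-- `σ_{{a} ∆ {b}} = σ_a σ_b` for `a ≠ b`. [folklore] -/
private theorem spinProduct_symmDiff_singleton {α : Type*} [DecidableEq α] {a b : α} (h : a ≠ b)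
    (ω : SpinConfig α) : spinProduct (({a} : Finset α) ∆ {b}) ω = spinAt a ω * spinAt b ω := by
  rw [← pair_eq_symmDiff' h, spinProduct, Finset.prod_pair h]

/-- The support of the edge term `{v, w}` with both endpoints in `Λ` is `{v} ∆ {w}` (Friedli–Velenik
2017, §3.8.1, p. 141: `C = {i, j} ⊂ Λ`). [cite: FriedliVelenik2017, §3.8.1, p. 141] -/
theorem isingSupp_inl_pair {Λ : Finset V} {v w : V} (hv : v ∈ Λ) (hw : w ∈ Λ) (hvw : v ≠ w) :
    isingSupp Λ (.inl s(v, w)) = ({⟨v, hv⟩} : Finset ↥Λ) ∆ {⟨w, hw⟩} := by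
  rw [← pair_eq_symmDiff' (fun h => hvw (Subtype.ext_iff.1 h))]
  ext z
  simp only [isingSupp, Finset.mem_filter, Finset.mem_univ, true_and, Sym2.mem_iff,
    Finset.mem_insert, Finset.mem_singleton, Subtype.ext_iff]

variable {d : ℕ}

/-- Consecutive points of a coordinate axis are neighbours in `ℤ^d`. [folklore] -/
private theorem zdGraph_adj_add_single_succ (y : Site d) (i : Fin d) (m : ℤ) :
    (zdGraph d).Adj (y + Pi.single i m) (y + Pi.single i (m + 1)) := by
  rw [zdGraph_adj_iff]
  exact ⟨i, Or.inl (by rw [Pi.single_add, add_assoc])⟩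

/-- An edge of `ℤ^d` with an endpoint in `Λ` is an interaction term of the box. [cite: FriedliVelenik2017, §3.1 (ℰ_Λ^b)] -/
theorem mk_mem_edgesTouching_of_adj {Λ : Finset (Site d)} {v w : Site d} (hadj : (zdGraph d).Adj v w)
    (hv : v ∈ Λ) : s(v, w) ∈ edgesTouching (zdGraph d) Λ :=
  mem_edgesTouching_iff.2 ⟨(SimpleGraph.mem_edgeSet (G := zdGraph d)).2 hadj, v, hv, Sym2.mem_mk_left v w⟩

/-- **The twisted coupling of a monochromatic edge is `2β`**: for the `+` b.c. box at field `0`,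
`K_e(1 + ω''_{C_e}) = β (1 + ω''_v ω''_w) = 2β` when `ω''_v = ω''_w` (Friedli–Velenik 2017, proof of
Thm. 3.49, p. 142, «coupling constants `K_C(1 + ω''_C)`»). [cite: FriedliVelenik2017, proof of Thm. 3.49, p. 142] -/
theorem twistedCoupling_edge_eq_two_mul {Λ : Finset (Site d)} (β : ℝ) {v w : Site d} (hv : v ∈ Λ)
    (hw : w ∈ Λ) (hadj : (zdGraph d).Adj v w) (ω'' : SpinConfig ↥Λ) (hvw : ω'' ⟨v, hv⟩ = ω'' ⟨w, hw⟩) :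
    gksCoupling (zdGraph d) Λ β 0 .plus (.inl s(v, w)) +
        gksCoupling (zdGraph d) Λ β 0 .plus (.inl s(v, w)) *
          spinProduct (isingSupp Λ (.inl s(v, w))) ω'' = 2 * β := by
  rw [gksCoupling_plus_inl (zdGraph d) β 0 (mk_mem_edgesTouching_of_adj hadj hv),
    isingSupp_inl_pair hv hw hadj.ne,
    spinProduct_symmDiff_singleton (fun h => hadj.ne (Subtype.ext_iff.1 h)),
    show spinAt (⟨v, hv⟩ : ↥Λ) ω'' = spinAt (⟨w, hw⟩ : ↥Λ) ω'' by rw [spinAt, spinAt, hvw], spinAt_mul_self]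
  ring

/-- **Griffiths' chain bound along a monochromatic axis segment, twisted system.** In the `+` b.c.
Ising box at field `0`, for the duplicated-system couplings `K(1+ω'')` and a segment
`y, y + e_i, …, y + n e_i ⊆ Λ` on which `ω''` is constant,
`⟨σ_y σ_{y+ne_i}⟩_{K(1+ω'')} ≥ tanh(2β)^n` (each bond of the segment has twisted coupling `2β`).
[cite: FriedliVelenik2017, Thm. 3.49 (3.55) and Exercise 3.31, pp. 141–142] -/
theorem twisted_gksExpect_axisSegment_ge {Λ : Finset (Site d)} {β : ℝ} (hβ : 0 ≤ β)
    (ω'' : SpinConfig ↥Λ) (y : Site d) (i : Fin d) (n : ℕ)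
    (hmem : ∀ m : ℕ, m ≤ n → y + Pi.single i (m : ℤ) ∈ Λ) (s₀ : ℤˣ)
    (hmono : ∀ (m : ℕ) (hm : m ≤ n), ω'' ⟨y + Pi.single i (m : ℤ), hmem m hm⟩ = s₀) :
    Real.tanh (2 * β) ^ n ≤
      gksExpect (isingIdx (zdGraph d) Λ)
        (fun e => gksCoupling (zdGraph d) Λ β 0 .plus e +
          gksCoupling (zdGraph d) Λ β 0 .plus e * spinProduct (isingSupp Λ e) ω'')
        (isingSupp Λ) (spinProduct (inVol Λ {y} ∆ inVol Λ {y + Pi.single i (n : ℤ)})) := by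
  classical
  have hK'' := twisted_nonneg_of_nonneg (isingIdx (zdGraph d) Λ) (isingSupp Λ)
    (gksCoupling_nonneg (zdGraph d) (Λ := Λ) hβ le_rfl (bc := .plus) (Or.inr rfl)) ω''
  let u : ℕ → ↥Λ := fun m => if hm : m ≤ n then ⟨y + Pi.single i (m : ℤ), hmem m hm⟩
    else ⟨y + Pi.single i (n : ℤ), hmem n le_rfl⟩
  let e : ℕ → Sym2 (Site d) ⊕ Site d := fun m =>
    .inl s(y + Pi.single i (m : ℤ), y + Pi.single i ((m : ℤ) + 1))
  have hu : ∀ (m : ℕ) (hm : m ≤ n), u m = ⟨y + Pi.single i (m : ℤ), hmem m hm⟩ := fun m hm => by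
    simp only [u, dif_pos hm]
  have hsucc : ∀ m : ℕ, y + Pi.single i ((m : ℤ) + 1) = y + Pi.single i ((m + 1 : ℕ) : ℤ) := fun m => by
    push_cast; rfl
  have hchain := prod_tanh_le_gksExpect_chain (isingIdx (zdGraph d) Λ)
    (fun e => gksCoupling (zdGraph d) Λ β 0 .plus e +
      gksCoupling (zdGraph d) Λ β 0 .plus e * spinProduct (isingSupp Λ e) ω'')
    (isingSupp Λ) hK'' u e n (fun j hj => by
      have hadj := zdGraph_adj_add_single_succ y i (j : ℤ)
      have hj1 : j + 1 ≤ n := hj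
      have hmem1 : y + Pi.single i ((j : ℤ) + 1) ∈ Λ := by rw [hsucc]; exact hmem (j + 1) hj1
      refine ⟨?_, ?_⟩
      · exact Finset.inl_mem_disjSum.2 (mk_mem_edgesTouching_of_adj hadj (hmem j hj.le))
      · show isingSupp Λ (.inl s(y + Pi.single i (j : ℤ), y + Pi.single i ((j : ℤ) + 1))) = {u j} ∆ {u (j + 1)}
        have hu1 : u (j + 1) = ⟨y + Pi.single i ((j : ℤ) + 1), hmem1⟩ := by
          rw [hu (j + 1) hj1]; exact Subtype.ext (hsucc j).symm
        rw [isingSupp_inl_pair (hmem j hj.le) hmem1 hadj.ne, hu j hj.le, hu1])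
  -- the product of the twisted couplings along the segment
  have hprod : ∏ j ∈ Finset.range n, Real.tanh ((fun e => gksCoupling (zdGraph d) Λ β 0 .plus e +
      gksCoupling (zdGraph d) Λ β 0 .plus e * spinProduct (isingSupp Λ e) ω'') (e j)) =
      Real.tanh (2 * β) ^ n := by
    rw [← Finset.card_range n, ← Finset.prod_const, Finset.card_range]
    refine Finset.prod_congr rfl fun j hj => ?_
    rw [Finset.mem_range] at hj
    have hj1 : j + 1 ≤ n := hj
    have hmem1 : y + Pi.single i ((j : ℤ) + 1) ∈ Λ := by rw [hsucc]; exact hmem (j + 1) hj1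
    have hcol : ω'' ⟨y + Pi.single i (j : ℤ), hmem j hj.le⟩ = ω'' ⟨y + Pi.single i ((j : ℤ) + 1), hmem1⟩ := by
      rw [hmono j hj.le]
      have h2 := hmono (j + 1) hj1
      have : (⟨y + Pi.single i ((j : ℤ) + 1), hmem1⟩ : ↥Λ) = ⟨y + Pi.single i ((j + 1 : ℕ) : ℤ), hmem (j + 1) hj1⟩ :=
        Subtype.ext (hsucc j)
      rw [this, h2]
    show Real.tanh (gksCoupling (zdGraph d) Λ β 0 .plus (e j) +
      gksCoupling (zdGraph d) Λ β 0 .plus (e j) * spinProduct (isingSupp Λ (e j)) ω'') = _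
    rw [twistedCoupling_edge_eq_two_mul β (hmem j hj.le) hmem1 (zdGraph_adj_add_single_succ y i (j : ℤ)) ω'' hcol]
  -- the endpoints
  have hy : y ∈ Λ := by simpa using hmem 0 (Nat.zero_le n)
  have h0 : ({u 0} : Finset ↥Λ) = inVol Λ {y} := by
    rw [inVol_singleton hy, hu 0 (Nat.zero_le n)]
    congr 1
    exact Subtype.ext (by simp)
  have hn : ({u n} : Finset ↥Λ) = inVol Λ {y + Pi.single i (n : ℤ)} := by
    rw [inVol_singleton (hmem n le_rfl), hu n le_rfl]
  rw [hprod, h0, hn] at hchain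
  exact hchain

/-! ### §6 The flip cost of a set of sites, and the finite-volume lower bound -/

/-- **Flip cost of a set of sites in the `+` b.c. box at field `0`**: for the pattern
`p = -1` on `F`, `+1` off `F`, the interaction terms with `p_{Cᵢ} = -1` are edges touching `F`, so
`∑_{i : p_{Cᵢ} = -1} Kᵢ ≤ β · 2d · |F|` (every site of `ℤ^d` has `2d` neighbours, tree
`card_neighborFinset_zdGraph_holds`). [folklore] -/
private theorem flipCost_plus_box_le {Λ : Finset (Site d)} {β : ℝ} (hβ : 0 ≤ β) (F : Finset (Site d)) :
    ∑ i ∈ (isingIdx (zdGraph d) Λ) with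
        spinProduct (isingSupp Λ i) (fun z : ↥Λ => if (z : Site d) ∈ F then (-1 : ℤˣ) else 1) = -1,
      gksCoupling (zdGraph d) Λ β 0 .plus i ≤ β * (2 * d * #F) := by
  classical
  set p : SpinConfig ↥Λ := fun z : ↥Λ => if (z : Site d) ∈ F then (-1 : ℤˣ) else 1 with hp
  rw [Finset.sum_filter, isingIdx, Finset.sum_disjSum]
  -- site terms vanish (`K_{{x}} = β·0`)
  have hsites : ∑ x ∈ Λ, (if spinProduct (isingSupp Λ (.inr x)) p = -1 then
      gksCoupling (zdGraph d) Λ β 0 .plus (.inr x) else 0) = 0 := by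
    refine Finset.sum_eq_zero fun x _ => ?_
    simp [gksCoupling]
  rw [hsites, add_zero]
  -- edge terms: only edges touching `F`, each with coupling `β`
  have hE : ∀ e ∈ edgesTouching (zdGraph d) Λ,
      (if spinProduct (isingSupp Λ (.inl e)) p = -1 then gksCoupling (zdGraph d) Λ β 0 .plus (.inl e) else 0) ≤
        if e ∈ edgesTouching (zdGraph d) F then β else 0 := by
    intro e he
    split_ifs with h1 h2 h2
    · rw [gksCoupling_plus_inl (zdGraph d) β 0 he]
    · exfalso
      apply h2
      -- some endpoint of `e` in `Λ` carries `p = -1`, i.e. lies in `F`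
      have hex : ∃ z ∈ isingSupp Λ (.inl e), spinAt z p ≠ 1 := by
        by_contra hall
        push Not at hall
        exact absurd (h1 ▸ Finset.prod_eq_one hall : (-1 : ℝ) = 1) (by norm_num)
      obtain ⟨z, hz, hz1⟩ := hex
      have hzF : (z : Site d) ∈ F := by
        by_contra hzF
        exact hz1 (by simp [spinAt, hp, hzF])
      have hze : (z : Site d) ∈ e := by
        simpa [isingSupp] using hz
      exact mem_edgesTouching_iff.2 ⟨(mem_edgesTouching_iff.1 he).1, z, hzF, hze⟩
    · exact hβ
    · exact le_rfl
  refine (Finset.sum_le_sum hE).trans ?_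
  rw [← Finset.sum_filter, Finset.sum_const, nsmul_eq_mul, mul_comm]
  refine mul_le_mul_of_nonneg_left ?_ hβ
  have hsub : (edgesTouching (zdGraph d) Λ).filter (· ∈ edgesTouching (zdGraph d) F) ⊆
      edgesTouching (zdGraph d) F := fun e he => (Finset.mem_filter.1 he).2
  calc (#((edgesTouching (zdGraph d) Λ).filter (· ∈ edgesTouching (zdGraph d) F)) : ℝ)
      ≤ #(edgesTouching (zdGraph d) F) := by exact_mod_cast Finset.card_le_card hsub
    _ ≤ ∑ v ∈ F, (#((zdGraph d).incidenceFinset v) : ℝ) := by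
        rw [edgesTouching]; exact_mod_cast Finset.card_biUnion_le
    _ = ∑ v ∈ F, (2 * d : ℝ) := by
        refine Finset.sum_congr rfl fun v _ => ?_
        rw [SimpleGraph.card_incidenceFinset_eq_degree, ← SimpleGraph.card_neighborFinset_eq_degree,
          card_neighborFinset_zdGraph_holds v]
        push_cast; ring
    _ = 2 * d * #F := by rw [Finset.sum_const, nsmul_eq_mul]; ring

/-- Coordinates of the points `x + m e_k` and `x + m e_k + e_l`. [folklore] -/
private theorem coord_facts (x : Site d) {k l : Fin d} (hkl : k ≠ l) (m : ℤ) :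
    (x + Pi.single k m : Site d) k = x k + m ∧ (x + Pi.single k m : Site d) l = x l ∧
      (x + Pi.single k m + Pi.single l 1 : Site d) l = x l + 1 ∧
        (x + Pi.single k m + Pi.single l 1 : Site d) k = x k + m := by
  refine ⟨?_, ?_, ?_, ?_⟩
  · simp
  · simp [Pi.single_eq_of_ne hkl.symm]
  · simp [Pi.single_eq_of_ne hkl.symm]
  · simp [Pi.single_eq_of_ne hkl]

/-- Rearrangement of the four endpoints and two corner points in the `∆`-group:
`(a ∆ a') ∆ (b ∆ b') = ((a ∆ c₀) ∆ ((c₀ ∆ c₁) ∆ (b' ∆ c₁))) ∆ (a' ∆ b)`. [folklore] -/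
private theorem symmDiff_six {α : Type*} [DecidableEq α] (a a' b b' c₀ c₁ : Finset α) :
    (a ∆ a') ∆ (b ∆ b') = ((a ∆ c₀) ∆ ((c₀ ∆ c₁) ∆ (b' ∆ c₁))) ∆ (a' ∆ b) := by
  rw [symmDiff_comm b' c₁, symmDiff_assoc c₀ c₁, symmDiff_symmDiff_cancel_left, symmDiff_assoc a c₀,
    symmDiff_symmDiff_cancel_left, symmDiff_symmDiff_symmDiff_comm a b' a' b, symmDiff_comm b' b]

/-- **The chain estimate for the energy pair.** In the `+` b.c. Ising box at field `0`, let `ω''` be a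
configuration of the duplicated system which is `-1` on the segment `x, …, x + (N-1)e_k` and `+1`
on the detour `x - e_k, x - e_k + e_l, …, x + N e_k + e_l, x + N e_k` (all inside `Λ`). Then
`⟨σ_{x-e_k}σ_x σ_{x+(N-1)e_k}σ_{x+Ne_k}⟩_{K(1+ω'')} ≥ tanh(2β)^{2N+2}`: GKS II splits the four-point
function into the two-point functions along the segment (`N-1` bonds) and along the detour
(`1 + (N+1) + 1` bonds), each bounded by `twisted_gksExpect_axisSegment_ge`.
[cite: FriedliVelenik2017, Thm. 3.49 (3.55) and Exercise 3.31, pp. 141–142] -/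
theorem energyPair_twisted_fourPoint_ge {k l : Fin d} (hkl : k ≠ l) {β : ℝ} (hβ : 0 ≤ β)
    (x : Site d) {N : ℕ} (hN : 1 ≤ N) {Λ : Finset (Site d)}
    (hΛ : (Finset.Icc (-1 : ℤ) N).image (fun m => x + Pi.single k m) ∪
      (Finset.Icc (-1 : ℤ) N).image (fun m => x + Pi.single k m + Pi.single l 1) ⊆ Λ)
    (ω'' : SpinConfig ↥Λ)
    (colF : ∀ z : ↥Λ, (z : Site d) ∈ (Finset.range N).image (fun j : ℕ => x + Pi.single k (j : ℤ)) →
      ω'' z = -1)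
    (colD : ∀ z : ↥Λ, (z : Site d) ∈ (Finset.range (N + 2)).image
        (fun j : ℕ => x + Pi.single k ((j : ℤ) - 1) + Pi.single l 1) ∪
          {x - Pi.single k 1, x + Pi.single k (N : ℤ)} → ω'' z = 1) :
    Real.tanh (2 * β) ^ (2 * N + 2) ≤
      gksExpect (isingIdx (zdGraph d) Λ)
        (fun e => gksCoupling (zdGraph d) Λ β 0 .plus e +
          gksCoupling (zdGraph d) Λ β 0 .plus e * spinProduct (isingSupp Λ e) ω'')
        (isingSupp Λ)
        (spinProduct (inVol Λ ({x - Pi.single k 1, x} : Finset (Site d)) ∆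
          inVol Λ ({x + Pi.single k (N : ℤ) - Pi.single k 1, x + Pi.single k (N : ℤ)} : Finset (Site d)))) := by
  classical
  -- membership in `Λ`
  have memk : ∀ m : ℤ, -1 ≤ m → m ≤ N → x + Pi.single k m ∈ Λ := fun m h1 h2 =>
    hΛ (Finset.mem_union_left _ (Finset.mem_image.2 ⟨m, Finset.mem_Icc.2 ⟨h1, h2⟩, rfl⟩))
  have meml : ∀ m : ℤ, -1 ≤ m → m ≤ N → x + Pi.single k m + Pi.single l 1 ∈ Λ := fun m h1 h2 =>
    hΛ (Finset.mem_union_right _ (Finset.mem_image.2 ⟨m, Finset.mem_Icc.2 ⟨h1, h2⟩, rfl⟩))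
  have ha_eq : x - Pi.single k 1 = x + Pi.single k (-1) := by rw [Pi.single_neg, sub_eq_add_neg]
  have hb_eq : x + Pi.single k (N : ℤ) - Pi.single k 1 = x + Pi.single k ((N : ℤ) - 1) := by
    rw [Pi.single_sub, add_sub_assoc]
  have hN1 : (((N - 1 : ℕ) : ℤ)) = (N : ℤ) - 1 := by push_cast [Nat.cast_sub hN]; ring
  have ha : x - Pi.single k 1 ∈ Λ := by rw [ha_eq]; exact memk (-1) le_rfl (by omega)
  have ha' : x ∈ Λ := by simpa using memk 0 (by norm_num) (by omega)
  have hb : x + Pi.single k (N : ℤ) - Pi.single k 1 ∈ Λ := by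
    rw [hb_eq]; exact memk _ (by omega) (by omega)
  have hb' : x + Pi.single k (N : ℤ) ∈ Λ := memk _ (by omega) le_rfl
  have hc₀ : x - Pi.single k 1 + Pi.single l 1 ∈ Λ := by rw [ha_eq]; exact meml (-1) le_rfl (by omega)
  have hcoord := fun m : ℤ => coord_facts x hkl m
  have haa' : x - Pi.single k 1 ≠ x := by
    rw [ha_eq]; intro h; have := congrFun h k; rw [(hcoord (-1)).1] at this; linarith
  have hbb' : x + Pi.single k (N : ℤ) - Pi.single k 1 ≠ x + Pi.single k (N : ℤ) := by
    rw [hb_eq]; intro h; have := congrFun h k; rw [(hcoord _).1, (hcoord _).1] at this; linarith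
  -- membership in the segment `F` and in the detour set `D`
  have hFmem : ∀ j : ℕ, j < N →
      x + Pi.single k (j : ℤ) ∈ (Finset.range N).image (fun j : ℕ => x + Pi.single k (j : ℤ)) :=
    fun j hj => Finset.mem_image.2 ⟨j, Finset.mem_range.2 hj, rfl⟩
  have hDmem : ∀ m : ℕ, m ≤ N + 1 → x + Pi.single k ((m : ℤ) - 1) + Pi.single l 1 ∈
      (Finset.range (N + 2)).image (fun j : ℕ => x + Pi.single k ((j : ℤ) - 1) + Pi.single l 1) ∪
        ({x - Pi.single k 1, x + Pi.single k (N : ℤ)} : Finset (Site d)) := fun m hm =>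
    Finset.mem_union_left _ (Finset.mem_image.2 ⟨m, Finset.mem_range.2 (by omega), rfl⟩)
  have hDa : x - Pi.single k 1 ∈
      (Finset.range (N + 2)).image (fun j : ℕ => x + Pi.single k ((j : ℤ) - 1) + Pi.single l 1) ∪
        ({x - Pi.single k 1, x + Pi.single k (N : ℤ)} : Finset (Site d)) :=
    Finset.mem_union_right _ (Finset.mem_insert_self _ _)
  have hDb' : x + Pi.single k (N : ℤ) ∈
      (Finset.range (N + 2)).image (fun j : ℕ => x + Pi.single k ((j : ℤ) - 1) + Pi.single l 1) ∪
        ({x - Pi.single k 1, x + Pi.single k (N : ℤ)} : Finset (Site d)) :=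
    Finset.mem_union_right _ (Finset.mem_insert_of_mem (Finset.mem_singleton_self _))
  -- (4) the segment `x, …, x + (N-1)e_k`, colour `-1`
  have h4 := twisted_gksExpect_axisSegment_ge (Λ := Λ) hβ ω'' x k (N - 1)
    (fun m hm => memk m (by omega) (by omega)) (-1) (fun m hm => colF _ (hFmem m (by omega)))
  -- (1) the bond `x - e_k ∼ x - e_k + e_l`, colour `+1`
  have h1 := twisted_gksExpect_axisSegment_ge (Λ := Λ) hβ ω'' (x - Pi.single k 1) l 1
    (fun m hm => by
      rcases Nat.le_one_iff_eq_zero_or_eq_one.1 hm with rfl | rfl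
      · simpa using ha
      · simpa using hc₀) 1
    (fun m hm => by
      rcases Nat.le_one_iff_eq_zero_or_eq_one.1 hm with rfl | rfl
      · refine colD _ ?_
        simp only [Nat.cast_zero, Pi.single_zero, add_zero]
        exact hDa
      · refine colD _ ?_
        have : x - Pi.single k 1 + Pi.single l ((1 : ℕ) : ℤ) = x + Pi.single k (((0 : ℕ) : ℤ) - 1) + Pi.single l 1 := by
          rw [ha_eq]; simp
        show x - Pi.single k 1 + Pi.single l ((1 : ℕ) : ℤ) ∈ _
        rw [this]; exact hDmem 0 (by omega))
  -- (2) the detour segment `x - e_k + e_l, …, x + N e_k + e_l`, colour `+1`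
  have hshift : ∀ m : ℕ, x - Pi.single k 1 + Pi.single l 1 + Pi.single k (m : ℤ) =
      x + Pi.single k ((m : ℤ) - 1) + Pi.single l 1 := fun m => by
    rw [ha_eq, show (m : ℤ) - 1 = -1 + m by ring, Pi.single_add]; abel
  have h2 := twisted_gksExpect_axisSegment_ge (Λ := Λ) hβ ω'' (x - Pi.single k 1 + Pi.single l 1) k (N + 1)
    (fun m hm => by rw [hshift]; exact meml _ (by omega) (by omega)) 1
    (fun m hm => colD _ (by
      show x - Pi.single k 1 + Pi.single l 1 + Pi.single k (m : ℤ) ∈ _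
      rw [hshift]; exact hDmem m hm))
  -- (3) the bond `x + N e_k ∼ x + N e_k + e_l`, colour `+1`
  have h3 := twisted_gksExpect_axisSegment_ge (Λ := Λ) hβ ω'' (x + Pi.single k (N : ℤ)) l 1
    (fun m hm => by
      rcases Nat.le_one_iff_eq_zero_or_eq_one.1 hm with rfl | rfl
      · simpa using hb'
      · simpa using meml N (by omega) le_rfl) 1
    (fun m hm => by
      rcases Nat.le_one_iff_eq_zero_or_eq_one.1 hm with rfl | rfl
      · refine colD _ ?_
        simp only [Nat.cast_zero, Pi.single_zero, add_zero]
        exact hDb'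
      · refine colD _ ?_
        have : x + Pi.single k (N : ℤ) + Pi.single l ((1 : ℕ) : ℤ) =
            x + Pi.single k ((((N + 1 : ℕ) : ℤ)) - 1) + Pi.single l 1 := by simp
        show x + Pi.single k (N : ℤ) + Pi.single l ((1 : ℕ) : ℤ) ∈ _
        rw [this]; exact hDmem (N + 1) le_rfl)
  -- endpoints in normal form
  have e1 : x - Pi.single k 1 + Pi.single l ((1 : ℕ) : ℤ) = x - Pi.single k 1 + Pi.single l 1 := by simp
  have e2 : x - Pi.single k 1 + Pi.single l 1 + Pi.single k (((N + 1 : ℕ)) : ℤ) =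
      x + Pi.single k (N : ℤ) + Pi.single l 1 := by
    rw [hshift]; congr 2; push_cast; ring
  have e3 : x + Pi.single k (N : ℤ) + Pi.single l ((1 : ℕ) : ℤ) = x + Pi.single k (N : ℤ) + Pi.single l 1 := by
    simp
  have e4 : x + Pi.single k (((N - 1 : ℕ)) : ℤ) = x + Pi.single k (N : ℤ) - Pi.single k 1 := by rw [hN1, hb_eq]
  rw [e1] at h1
  rw [e2] at h2
  rw [e3] at h3
  rw [e4] at h4
  -- glue with GKS II in the twisted system
  have hK : ∀ i ∈ isingIdx (zdGraph d) Λ, 0 ≤ gksCoupling (zdGraph d) Λ β 0 .plus i :=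
    gksCoupling_nonneg (zdGraph d) (Λ := Λ) hβ le_rfl (bc := .plus) (Or.inr rfl)
  have hK'' := twisted_nonneg_of_nonneg (isingIdx (zdGraph d) Λ) (isingSupp Λ) hK ω''
  rw [pair_eq_symmDiff' haa', pair_eq_symmDiff' hbb', inVol_symmDiff, inVol_symmDiff,
    symmDiff_six _ _ _ _ (inVol Λ {x - Pi.single k 1 + Pi.single l 1})
      (inVol Λ {x + Pi.single k (N : ℤ) + Pi.single l 1})]
  have nn := fun X => gksExpect_spinProduct_nonneg (isingIdx (zdGraph d) Λ)
    (fun e => gksCoupling (zdGraph d) Λ β 0 .plus e +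
      gksCoupling (zdGraph d) Λ β 0 .plus e * spinProduct (isingSupp Λ e) ω'') (isingSupp Λ) hK'' X
  have gks2 := fun X Y => gksExpect_mul_gksExpect_le (isingIdx (zdGraph d) Λ)
    (fun e => gksCoupling (zdGraph d) Λ β 0 .plus e +
      gksCoupling (zdGraph d) Λ β 0 .plus e * spinProduct (isingSupp Λ e) ω'') (isingSupp Λ) hK'' X Y
  have t0 : 0 ≤ Real.tanh (2 * β) := tanh_nonneg_aux (by linarith)
  have hpow : Real.tanh (2 * β) ^ (2 * N + 2) =
      (Real.tanh (2 * β) ^ 1 * (Real.tanh (2 * β) ^ (N + 1) * Real.tanh (2 * β) ^ 1)) *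
        Real.tanh (2 * β) ^ (N - 1) := by
    rw [← pow_add, ← pow_add, ← pow_add]; congr 1; omega
  rw [hpow]
  refine le_trans ?_ (gks2 _ _)
  refine mul_le_mul ?_ h4 (pow_nonneg t0 _) (nn _)
  refine le_trans ?_ (gks2 _ _)
  refine mul_le_mul h1 ?_ (mul_nonneg (pow_nonneg t0 _) (pow_nonneg t0 _)) (nn _)
  refine le_trans ?_ (gks2 _ _)
  exact mul_le_mul h2 h3 (pow_nonneg t0 _) (nn _)

/-- **Finite-energy lower bound for the energy–energy truncated correlation of the plus-boundary
Ising model in finite volume.** Let `d ≥ 2` (two coordinate directions `k ≠ l`), `β ≥ 0`, `N ≥ 1`, and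
let `Λ ⊆ ℤ^d` contain the `2 × (N+2)` strip `{x + m e_k, x + m e_k + e_l : -1 ≤ m ≤ N}`. Then for the
`+` b.c. Ising model on `Λ` at inverse temperature `β` and field `0`,
`⟨σ_{x-e_k}σ_x σ_{x+(N-1)e_k}σ_{x+Ne_k}⟩⁺_Λ - ⟨σ_{x-e_k}σ_x⟩⁺_Λ ⟨σ_{x+(N-1)e_k}σ_{x+Ne_k}⟩⁺_Λ
  ≥ 2 tanh(2β)^{2N+2} e^{-4dβN} 2^{-(2N+4)}`,
uniformly in `Λ`. Proof: `gksExpect_truncated_ge` with the pattern `p = -1` on the segment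
`x, …, x+(N-1)e_k` (flip cost `≤ 2dβN`, `flipCost_plus_box_le`), `T` = segment ∪ detour
`x-e_k, x-e_k+e_l, …, x+Ne_k+e_l, x+Ne_k` (`|T| ≤ 2N+4`), and the chain estimate
`energyPair_twisted_fourPoint_ge`. (Duncan–Schweinhart 2026, Prop. 24, state the corresponding
«trivial exponential lower bound» for the dual gauge-theory quantity via finite energy of the
plaquette random-cluster measure.) [cite: DuncanSchweinhart2026, Prop. 24 (p. 19)] -/
theorem isingCorr_plus_energyPair_truncated_ge {k l : Fin d} (hkl : k ≠ l) {β : ℝ} (hβ : 0 ≤ β)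
    (x : Site d) {N : ℕ} (hN : 1 ≤ N) {Λ : Finset (Site d)}
    (hΛ : (Finset.Icc (-1 : ℤ) N).image (fun m => x + Pi.single k m) ∪
      (Finset.Icc (-1 : ℤ) N).image (fun m => x + Pi.single k m + Pi.single l 1) ⊆ Λ) :
    2 * Real.tanh (2 * β) ^ (2 * N + 2) * (Real.exp (-(4 * d * β * N)) * ((2 : ℝ) ^ (2 * N + 4))⁻¹) ≤
      isingCorr (zdGraph d) Λ β 0 .plus
          (({x - Pi.single k 1, x} : Finset (Site d)) ∆
            {x + Pi.single k (N : ℤ) - Pi.single k 1, x + Pi.single k (N : ℤ)}) -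
        isingCorr (zdGraph d) Λ β 0 .plus {x - Pi.single k 1, x} *
          isingCorr (zdGraph d) Λ β 0 .plus {x + Pi.single k (N : ℤ) - Pi.single k 1, x + Pi.single k (N : ℤ)} := by
  classical
  -- ### membership in `Λ` and normal forms
  have memk : ∀ m : ℤ, -1 ≤ m → m ≤ N → x + Pi.single k m ∈ Λ := fun m h1 h2 =>
    hΛ (Finset.mem_union_left _ (Finset.mem_image.2 ⟨m, Finset.mem_Icc.2 ⟨h1, h2⟩, rfl⟩))
  have ha_eq : x - Pi.single k 1 = x + Pi.single k (-1) := by rw [Pi.single_neg, sub_eq_add_neg]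
  have hb_eq : x + Pi.single k (N : ℤ) - Pi.single k 1 = x + Pi.single k ((N : ℤ) - 1) := by
    rw [Pi.single_sub, add_sub_assoc]
  have hN1 : (((N - 1 : ℕ) : ℤ)) = (N : ℤ) - 1 := by push_cast [Nat.cast_sub hN]; ring
  have ha : x - Pi.single k 1 ∈ Λ := by rw [ha_eq]; exact memk (-1) le_rfl (by omega)
  have ha' : x ∈ Λ := by simpa using memk 0 (by norm_num) (by omega)
  have hb : x + Pi.single k (N : ℤ) - Pi.single k 1 ∈ Λ := by
    rw [hb_eq]; exact memk _ (by omega) (by omega)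
  have hb' : x + Pi.single k (N : ℤ) ∈ Λ := memk _ (by omega) le_rfl
  have hcoord := fun m : ℤ => coord_facts x hkl m
  have hne_k : ∀ m m' : ℤ, m ≠ m' → x + Pi.single k m ≠ x + Pi.single k m' := by
    intro m m' hmm h
    have := congrFun h k
    rw [(hcoord m).1, (hcoord m').1] at this
    exact hmm (by linarith)
  have hbb' : x + Pi.single k (N : ℤ) - Pi.single k 1 ≠ x + Pi.single k (N : ℤ) := by
    rw [hb_eq]; exact hne_k _ _ (by linarith)
  -- ### the flipped segment `F`, the detour `D`, the pattern `p`, the frozen set `T`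
  set F : Finset (Site d) := (Finset.range N).image (fun j : ℕ => x + Pi.single k (j : ℤ)) with hF
  set D : Finset (Site d) := (Finset.range (N + 2)).image
      (fun j : ℕ => x + Pi.single k ((j : ℤ) - 1) + Pi.single l 1) ∪ {x - Pi.single k 1, x + Pi.single k (N : ℤ)}
    with hD
  set p : SpinConfig ↥Λ := fun z : ↥Λ => if (z : Site d) ∈ F then (-1 : ℤˣ) else 1 with hp
  have hFmem : ∀ j : ℕ, j < N → x + Pi.single k (j : ℤ) ∈ F := fun j hj =>
    Finset.mem_image.2 ⟨j, Finset.mem_range.2 hj, rfl⟩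
  have hF_iff : ∀ z : Site d, z ∈ F ↔ ∃ j : ℕ, j < N ∧ x + Pi.single k (j : ℤ) = z := fun z => by
    simp only [hF, Finset.mem_image, Finset.mem_range]
  have hbF : x + Pi.single k (N : ℤ) - Pi.single k 1 ∈ F := by
    rw [hb_eq, ← hN1]; exact hFmem (N - 1) (by omega)
  -- the detour set misses `F`
  have hD_notF : ∀ z : Site d, z ∈ D → z ∉ F := by
    intro z hz hzF
    obtain ⟨j, hj, hjz⟩ := (hF_iff z).1 hzF
    rw [hD, Finset.mem_union, Finset.mem_image, Finset.mem_insert, Finset.mem_singleton] at hz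
    rcases hz with ⟨m, -, hmz⟩ | rfl | rfl
    · have := congrFun (hjz.trans hmz.symm) l
      rw [(hcoord (j : ℤ)).2.1, (hcoord _).2.2.1] at this
      linarith
    · rw [ha_eq] at hjz; exact hne_k _ _ (by omega) hjz
    · exact hne_k _ _ (by omega) hjz
  have hDb' : x + Pi.single k (N : ℤ) ∈ D :=
    Finset.mem_union_right _ (Finset.mem_insert_of_mem (Finset.mem_singleton_self _))
  -- ### apply the abstract bound
  have hK : ∀ i ∈ isingIdx (zdGraph d) Λ, 0 ≤ gksCoupling (zdGraph d) Λ β 0 .plus i :=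
    gksCoupling_nonneg (zdGraph d) (Λ := Λ) hβ le_rfl (bc := .plus) (Or.inr rfl)
  have hBT : inVol Λ ({x + Pi.single k (N : ℤ) - Pi.single k 1, x + Pi.single k (N : ℤ)} : Finset (Site d)) ⊆
      inVol Λ (F ∪ D) := by
    intro z hz
    rw [mem_inVol, Finset.mem_insert, Finset.mem_singleton] at hz
    rw [mem_inVol, Finset.mem_union]
    rcases hz with h | h
    · rw [h]; exact Or.inl hbF
    · rw [h]; exact Or.inr hDb'
  have hBp : spinProduct (inVol Λ ({x + Pi.single k (N : ℤ) - Pi.single k 1, x + Pi.single k (N : ℤ)} :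
      Finset (Site d))) p = -1 := by
    rw [pair_eq_symmDiff' hbb', inVol_symmDiff, inVol_singleton hb, inVol_singleton hb',
      spinProduct_symmDiff_singleton (fun h => hbb' (Subtype.ext_iff.1 h)), spinAt, spinAt]
    have h1 : p ⟨x + Pi.single k (N : ℤ) - Pi.single k 1, hb⟩ = -1 := by simp [hp, hbF]
    have h2 : p ⟨x + Pi.single k (N : ℤ), hb'⟩ = 1 := by simp [hp, hD_notF _ hDb']
    rw [h1, h2]; norm_num
  have hc0 : 0 ≤ Real.tanh (2 * β) ^ (2 * N + 2) := pow_nonneg (tanh_nonneg_aux (by linarith)) _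
  have hmain : 2 * Real.tanh (2 * β) ^ (2 * N + 2) *
      (Real.exp (-2 * ∑ i ∈ (isingIdx (zdGraph d) Λ) with spinProduct (isingSupp Λ i) p = -1,
          gksCoupling (zdGraph d) Λ β 0 .plus i) * ((2 : ℝ) ^ #(inVol Λ (F ∪ D)))⁻¹) ≤
      gksExpect (isingIdx (zdGraph d) Λ) (gksCoupling (zdGraph d) Λ β 0 .plus) (isingSupp Λ)
          (spinProduct (inVol Λ ({x - Pi.single k 1, x} : Finset (Site d)) ∆
            inVol Λ ({x + Pi.single k (N : ℤ) - Pi.single k 1, x + Pi.single k (N : ℤ)} : Finset (Site d)))) -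
        gksExpect (isingIdx (zdGraph d) Λ) (gksCoupling (zdGraph d) Λ β 0 .plus) (isingSupp Λ)
            (spinProduct (inVol Λ ({x - Pi.single k 1, x} : Finset (Site d)))) *
          gksExpect (isingIdx (zdGraph d) Λ) (gksCoupling (zdGraph d) Λ β 0 .plus) (isingSupp Λ)
            (spinProduct (inVol Λ ({x + Pi.single k (N : ℤ) - Pi.single k 1, x + Pi.single k (N : ℤ)} :
              Finset (Site d)))) :=
    gksExpect_truncated_ge _ _ _ hK _ _ _ p hBT hBp hc0 (fun ω'' hω =>
      energyPair_twisted_fourPoint_ge hkl hβ x hN hΛ ω''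
        (fun z hzF => by
          have hzT : z ∈ inVol Λ (F ∪ D) := mem_inVol.2 (Finset.mem_union_left _ hzF)
          have hzF' : (z : Site d) ∈ F := hzF
          rw [hω z hzT]
          simp [hp, hzF'])
        (fun z hzD => by
          have hzT : z ∈ inVol Λ (F ∪ D) := mem_inVol.2 (Finset.mem_union_right _ hzD)
          have hzF' : (z : Site d) ∉ F := hD_notF _ hzD
          rw [hω z hzT]
          simp [hp, hzF']))
  -- ### rewrite the Ising correlations as `gksExpect`
  have hAsub : ({x - Pi.single k 1, x} : Finset (Site d)) ⊆ Λ := by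
    intro z hz; rw [Finset.mem_insert, Finset.mem_singleton] at hz
    rcases hz with rfl | rfl
    exacts [ha, ha']
  have hBsub : ({x + Pi.single k (N : ℤ) - Pi.single k 1, x + Pi.single k (N : ℤ)} : Finset (Site d)) ⊆ Λ := by
    intro z hz; rw [Finset.mem_insert, Finset.mem_singleton] at hz
    rcases hz with rfl | rfl
    exacts [hb, hb']
  have hABsub : (({x - Pi.single k 1, x} : Finset (Site d)) ∆
      {x + Pi.single k (N : ℤ) - Pi.single k 1, x + Pi.single k (N : ℤ)}) ⊆ Λ := fun z hz => by
    rw [Finset.mem_symmDiff] at hz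
    rcases hz with h | h
    exacts [hAsub h.1, hBsub h.1]
  rw [isingCorr_eq_gksExpect (zdGraph d) Λ β 0 .plus hABsub, isingCorr_eq_gksExpect (zdGraph d) Λ β 0 .plus hAsub,
    isingCorr_eq_gksExpect (zdGraph d) Λ β 0 .plus hBsub, inVol_symmDiff]
  refine le_trans ?_ hmain
  -- ### the constants: flip cost `≤ 2dβN`, `|T| ≤ 2N + 4`
  have hF_card : #F ≤ N := by
    simpa using Finset.card_image_le (s := Finset.range N) (f := fun j : ℕ => x + Pi.single k (j : ℤ))
  have hflip : ∑ i ∈ (isingIdx (zdGraph d) Λ) with spinProduct (isingSupp Λ i) p = -1,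
      gksCoupling (zdGraph d) Λ β 0 .plus i ≤ 2 * d * β * N := by
    refine (flipCost_plus_box_le (Λ := Λ) hβ F).trans ?_
    have hF' : (#F : ℝ) ≤ N := by exact_mod_cast hF_card
    have h2 : (0 : ℝ) ≤ 2 * d * β := by positivity
    calc β * (2 * d * #F) = 2 * d * β * #F := by ring
      _ ≤ 2 * d * β * N := mul_le_mul_of_nonneg_left hF' h2
  have hTcard : #(inVol Λ (F ∪ D)) ≤ 2 * N + 4 := by
    refine (card_inVol_le Λ (F ∪ D)).trans ((Finset.card_union_le F D).trans ?_)
    have h2 : #D ≤ (N + 2) + 2 := by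
      refine (Finset.card_union_le _ _).trans (Nat.add_le_add ?_ Finset.card_le_two)
      simpa using Finset.card_image_le (s := Finset.range (N + 2))
        (f := fun j : ℕ => x + Pi.single k ((j : ℤ) - 1) + Pi.single l 1)
    omega
  have hexp : Real.exp (-(4 * d * β * N)) ≤
      Real.exp (-2 * ∑ i ∈ (isingIdx (zdGraph d) Λ) with spinProduct (isingSupp Λ i) p = -1,
        gksCoupling (zdGraph d) Λ β 0 .plus i) :=
    Real.exp_le_exp.2 (by linarith)
  have hTpow : ((2 : ℝ) ^ (2 * N + 4))⁻¹ ≤ ((2 : ℝ) ^ #(inVol Λ (F ∪ D)))⁻¹ :=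
    inv_anti₀ (by positivity) (pow_le_pow_right₀ (by norm_num) hTcard)
  exact mul_le_mul_of_nonneg_left (mul_le_mul hexp hTpow (by positivity) (by positivity)) (by positivity)

/-! ### §7 Infinite volume: the plus state of `ℤ^d` -/

/-- **Finite-energy lower bound for the energy–energy truncated correlation of the plus state on
`ℤ^d`** (`d ≥ 2`: two directions `k ≠ l`; `β ≥ 0`, field `0`, `N ≥ 1`):
`⟨σ_{x-e_k}σ_x ; σ_{x+(N-1)e_k}σ_{x+Ne_k}⟩⁺_β ≥ 2 tanh(2β)^{2N+2} e^{-4dβN} 2^{-(2N+4)}`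
— the box limit (tree `hasBoxLimit_isingCorr_plus_holds`) of `isingCorr_plus_energyPair_truncated_ge`.
[cite: DuncanSchweinhart2026, Prop. 24 (p. 19); FriedliVelenik2017, Thm. 3.49 (pp. 141–142)] -/
theorem plusCorr_energyPair_truncated_ge {k l : Fin d} (hkl : k ≠ l) {β : ℝ} (hβ : 0 ≤ β)
    (x : Site d) {N : ℕ} (hN : 1 ≤ N) :
    2 * Real.tanh (2 * β) ^ (2 * N + 2) * (Real.exp (-(4 * d * β * N)) * ((2 : ℝ) ^ (2 * N + 4))⁻¹) ≤
      plusCorr d β 0 (({x - Pi.single k 1, x} : Finset (Site d)) ∆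
          {x + Pi.single k (N : ℤ) - Pi.single k 1, x + Pi.single k (N : ℤ)}) -
        plusCorr d β 0 {x - Pi.single k 1, x} *
          plusCorr d β 0 {x + Pi.single k (N : ℤ) - Pi.single k 1, x + Pi.single k (N : ℤ)} := by
  have hlim := (hasBoxLimit_isingCorr_plus_holds (d := d) hβ le_rfl
      ((({x - Pi.single k 1, x} : Finset (Site d)) ∆
        {x + Pi.single k (N : ℤ) - Pi.single k 1, x + Pi.single k (N : ℤ)}))).sub
    ((hasBoxLimit_isingCorr_plus_holds (d := d) hβ le_rfl ({x - Pi.single k 1, x} : Finset (Site d))).mul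
      (hasBoxLimit_isingCorr_plus_holds (d := d) hβ le_rfl
        ({x + Pi.single k (N : ℤ) - Pi.single k 1, x + Pi.single k (N : ℤ)} : Finset (Site d))))
  obtain ⟨M₀, hM₀⟩ := exists_forall_subset_box (d := d)
    ((Finset.Icc (-1 : ℤ) N).image (fun m => x + Pi.single k m) ∪
      (Finset.Icc (-1 : ℤ) N).image (fun m => x + Pi.single k m + Pi.single l 1))
  refine ge_of_tendsto hlim (Filter.eventually_atTop.2 ⟨M₀, fun M hM => ?_⟩)
  exact isingCorr_plus_energyPair_truncated_ge hkl hβ x hN (hM₀ M hM)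

/-- Exponential packaging: `C₀ rᴺ ≥ e^{-c₁N}` for `N ≥ 1` when `0 < C₀ ≤ 1`, `0 < r < 1`
(`c₁ = -log(r C₀) > 0`). [folklore] -/
private theorem exists_exp_neg_mul_le_geometric {C₀ r : ℝ} (hC : 0 < C₀) (hC1 : C₀ ≤ 1) (hr : 0 < r)
    (hr1 : r < 1) : ∃ c₁ : ℝ, 0 < c₁ ∧ ∀ N : ℕ, 1 ≤ N → Real.exp (-(c₁ * N)) ≤ C₀ * r ^ N := by
  have hrC : r * C₀ < 1 := by nlinarith
  have hrC0 : 0 < r * C₀ := mul_pos hr hC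
  refine ⟨-Real.log (r * C₀), by rw [neg_pos]; exact Real.log_neg hrC0 hrC, fun N hN => ?_⟩
  rw [show -(-Real.log (r * C₀) * N) = (N : ℝ) * Real.log (r * C₀) by ring, Real.exp_nat_mul,
    Real.exp_log hrC0, mul_pow, mul_comm]
  refine mul_le_mul_of_nonneg_right ?_ (pow_nonneg hr.le N)
  calc C₀ ^ N ≤ C₀ ^ 1 := pow_le_pow_of_le_one hC.le hC1 hN
    _ = C₀ := pow_one C₀

/-- The bound of `plusCorr_energyPair_truncated_ge` as a geometric sequence. [folklore] -/
private theorem bound_eq_geometric (t E : ℝ) (N : ℕ) :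
    2 * t ^ (2 * N + 2) * (E ^ N * ((2 : ℝ) ^ (2 * N + 4))⁻¹) = t ^ 2 / 8 * (t ^ 2 * E / 4) ^ N := by
  rw [div_pow, mul_pow, ← pow_mul, pow_add, pow_add, pow_mul, pow_mul]
  norm_num
  field_simp
  ring

/-- **Exponential form**: for `β > 0` (and `d ≥ 2`) there is `c₁ = c₁(β, d) > 0` with
`⟨σ_{x-e_k}σ_x ; σ_{x+(N-1)e_k}σ_{x+Ne_k}⟩⁺_β ≥ e^{-c₁N}` for all `x` and all `N ≥ 1` — the
energy–energy truncated correlation of the plus state decays no faster than exponentially.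
[cite: DuncanSchweinhart2026, Prop. 24 (p. 19)] -/
theorem plusCorr_energyPair_truncated_ge_exp {k l : Fin d} (hkl : k ≠ l) {β : ℝ} (hβ : 0 < β) :
    ∃ c₁ : ℝ, 0 < c₁ ∧ ∀ (x : Site d) (N : ℕ), 1 ≤ N →
      Real.exp (-(c₁ * N)) ≤
        plusCorr d β 0 (({x - Pi.single k 1, x} : Finset (Site d)) ∆
            {x + Pi.single k (N : ℤ) - Pi.single k 1, x + Pi.single k (N : ℤ)}) -
          plusCorr d β 0 {x - Pi.single k 1, x} *
            plusCorr d β 0 {x + Pi.single k (N : ℤ) - Pi.single k 1, x + Pi.single k (N : ℤ)} := by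
  have ht0 : 0 < Real.tanh (2 * β) := by
    rw [Real.tanh_eq_sinh_div_cosh]
    exact div_pos (Real.sinh_pos_iff.2 (by linarith)) (Real.cosh_pos _)
  have ht1 : Real.tanh (2 * β) < 1 := Real.tanh_lt_one _
  have hE0 : 0 < Real.exp (-(4 * d * β)) := Real.exp_pos _
  have hE1 : Real.exp (-(4 * d * β)) ≤ 1 := Real.exp_le_one_iff.2 (by
    have : (0 : ℝ) ≤ d := Nat.cast_nonneg d
    nlinarith)
  have ht2 : Real.tanh (2 * β) ^ 2 < 1 := by nlinarith
  have hr0 : 0 < Real.tanh (2 * β) ^ 2 * Real.exp (-(4 * d * β)) / 4 := by positivity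
  have hr1 : Real.tanh (2 * β) ^ 2 * Real.exp (-(4 * d * β)) / 4 < 1 := by
    have : Real.tanh (2 * β) ^ 2 * Real.exp (-(4 * d * β)) ≤ Real.tanh (2 * β) ^ 2 * 1 :=
      mul_le_mul_of_nonneg_left hE1 (sq_nonneg _)
    linarith
  have hC : 0 < Real.tanh (2 * β) ^ 2 / 8 := by positivity
  have hC1 : Real.tanh (2 * β) ^ 2 / 8 ≤ 1 := by linarith
  obtain ⟨c₁, hc₁, hgeo⟩ := exists_exp_neg_mul_le_geometric hC hC1 hr0 hr1
  refine ⟨c₁, hc₁, fun x N hN => (hgeo N hN).trans (le_trans (le_of_eq ?_)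
    (plusCorr_energyPair_truncated_ge hkl hβ.le x hN))⟩
  rw [← bound_eq_geometric, ← Real.exp_nat_mul]
  congr 3
  ring

end IsingBox

end Literature.Probability.LatticeModels
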